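/- Lead `ym-line-cbag-p1` (prover-ym-line-cbag-p1-g7-0), route `ColdBoxAllGroups` (planner-of-record ym-idea-2): the EXPLICIT, `G`-UNIFORM
exponent of the rung leaf R2xi-G `XiPow` (helper of the closed cruxes stmt-QuantumFields-22254 / 22255). -/
import Summits.QuantumFields.YangMills.Theorems.ColdBoxAllGroupsBoxFloorAllGroupsExplicit
import Summits.QuantumFields.YangMills.Theorems.ColdBoxAllGroupsBulkAllGroupsCovStableGExplicit
import Summits.QuantumFields.YangMills.Theorems.ColdBoxAllGroupsBulkAllGroupsMeanSmoothGExplicit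
import Summits.QuantumFields.YangMills.Theorems.ColdBoxAllGroupsBulkAllGroupsFlatCovOfDomAbsG
import Summits.QuantumFields.YangMills.Theorems.ColdBoxAllGroupsBulkAllGroupsStubKernelCovExpansionG
import Summits.QuantumFields.YangMills.Theorems.ColdBoxAllGroupsBulkAllGroupsStubDlrAssemblyG
import Summits.QuantumFields.YangMills.Theorems.ColdBoxAllGroupsBulkAllGroupsStubLargeFieldRarityG
import Summits.QuantumFields.YangMills.Theorems.ColdBoxAllGroupsBulkAllGroupsBoxPolyFloorGOfBox
import Summits.QuantumFields.YangMills.Theorems.WeakCouplingRatesBulkDominatesColdBoxWStubDirKernelTwoPoint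
import Summits.QuantumFields.YangMills.Theorems.WeakCouplingRatesBulkDominatesColdBoxWDirKernelDiagFlat
import Summits.QuantumFields.YangMills.Theorems.WeakCouplingRatesCurvatureCorrPowerFloor
import Literature.MathematicalPhysics.QuantumFieldTheory.YangMillsOS
import Literature.MathematicalPhysics.QuantumLattice.GaugeGroupsProofs
import Literature.MathematicalPhysics.QuantumLattice.RepLieAlgebraUnitary

/-!
# `ξ(β) ≥ β^{1/8000}` for EVERY compact simple gauge group — the rung leaf R2xi-G `XiPow` with an explicit, `G`-UNIFORM exponent

The rung leaf `WeakCouplingRates.XiPow` (PROVED by route `ColdBoxAllGroups`, `xiPow_holds`) says: for every compact simple `G` (tree sense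
`IsCompactSimpleLieGroup`) and every faithful unitary lattice representation `r` there is SOME `ε > 0` with `MassGapPowerDecayOf 4 r.ρ ε`
(every torus-limit state of the 4-D Wilson theory has RP-spectral mass gap `≤ β^{−ε}` for `β ≥ β₀`).  The proofs of the two cruxes use the
SAME exponent windows for every `(G, r)` — BOX: `θ ≤ 1/100`; BULK: `θ ≤ 1/200` along `(A, δ, K) = (θ/20, θ/5, 2 + θ/2)`; `ε = A/2` — only
the thresholds `β₀` depend on the group, but the registered `∃`-packaged signatures hide this.  With the fixed-exponent twins
(`…BoxFloorAllGroupsExplicit`, `…BulkAllGroupsCovStableGExplicit`, `…BulkAllGroupsMeanSmoothGExplicit`) the whole composition runs at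
`θ = 1/200`, `A = 1/4000`, and the quantifiers swap:

* `flatCovExpansionG_explicit`, `goodBoundaryCovStableG_explicit`, `goodBoundaryMeanSmoothG_explicit`, `boxPolyFloorG_explicit` — the four
  BULK stubs L1a-G / L1b-G / L4-G (and N2-flat-G) at every `0 < θ ≤ 1/200` (resp. `≤ 1/100`);
* `bulkDominatesBox_allGroups_explicit` — **BULK_G at every `0 < θ ≤ 1/200`**: `BulkDominatesBox r.ρ (θ/20) θ` (DLR assembly L3-G);
* `massGapPowerDecay_allGroups_explicit` — **for every compact simple `G` and every `r`: `MassGapPowerDecayOf 4 r.ρ (1/8000)`**;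
* `xiPow_uniform` — **`∃ ε > 0, ∀ G, ∀ r, MassGapPowerDecayOf 4 r.ρ ε`** (the quantifier swap `∀G ∃ε ↦ ∃ε ∀G`; witness `ε = 1/8000`);
* `massGapPowerDecay_SU_explicit` / `massGapPowerDecay_SU3_explicit` — the instances `SU(N)`, `N ≥ 2` (fundamental), and `SU(3)`.

The exponent `1/8000` is what the registered interfaces give (`A = θ/20`, `ε = A/2`, BULK ceiling `1/200`); no optimisation is attempted.
HONEST LABEL: a RECORD-label statement of LADDER-YM (a power-rate UPPER bound on the lattice mass gap of torus-limit states at weak coupling,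
`ξ ≥ β^{1/8000}`, infinitely far from the expected `ξ ~ e^{cβ}`); it is NOT the Clay Yang–Mills mass gap and no summit statement is proved by
anything here.  No sorry; no new definition; standard axioms.
-/

set_option autoImplicit false

noncomputable section

open MeasureTheory Filter Topology
open Literature.MathematicalPhysics.QuantumLattice
open Literature.MathematicalPhysics.QuantumFieldTheory
open Summit.QuantumFields.YangMills.Theorems.WeakCouplingRates
open Summit.QuantumFields.YangMills.Theorems.FreeEnergyLogCoefficient (dimE)

namespace Summit.QuantumFields.YangMills.Theorems.ColdBoxAllGroups

/-! ## The BULK stubs at a fixed exponent -/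

/-- **N2-flat-G at every `0 < θ ≤ 1/100`**: `FlatCovExpansionG r.ρ (θ/20) θ` — the cold-wall two-plaquette covariance at separation `⌈β^{θ/20}⌉`
is its Dirichlet–Gaussian value `(D/2)·C_D²` up to `β^{−θ/2}` (from `boxDirichletDominationAbsG_explicit'`, `κ = 9θ`; body of
`flatCovExpansionG_of_domAbsG` at a fixed `θ`). [folklore] -/
theorem flatCovExpansionG_explicit
    (G : Type) [Group G] [TopologicalSpace G] [IsTopologicalGroup G] [CompactSpace G] [MeasurableSpace G] [BorelSpace G]
    (hG : IsCompactSimpleLieGroup G) (r : LatticeRep G) {θ : ℝ} (hθ : 0 < θ) (hθ1 : θ ≤ 1 / 100) :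
    FlatCovExpansionG r.ρ (θ / 20) θ := by
  obtain ⟨β₁, h₁⟩ := boxDirichletDominationAbsG_explicit' G hG r θ hθ hθ1
  unfold FlatCovExpansionG
  refine ⟨max β₁ 1, fun β hβ => ?_⟩
  have hβ₁ : β₁ ≤ β := le_trans (le_max_left _ _) hβ
  have hβ1 : (1 : ℝ) ≤ β := le_trans (le_max_right _ _) hβ
  have hT : ⌈β ^ (θ / 20)⌉₊ ≤ ⌈β ^ θ⌉₊ :=
    Nat.ceil_mono (Real.rpow_le_rpow_of_exponent_le hβ1 (by linarith))
  have h := h₁ β hβ₁ ⌈β ^ (θ / 20)⌉₊ hT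
  rw [boxDirCircSqCov_eq_two_mul_sq, ← boxDirProjKernel_centre_eq] at h
  set K : ℝ := boxDirProjKernel ⌈β ^ θ⌉₊ (boxCentre ⌈β ^ θ⌉₊, 1, 2)
    (boxCentre ⌈β ^ θ⌉₊ + Pi.single 0 (⌈β ^ (θ / 20)⌉₊ : ℤ), 1, 2) with hK
  have h34 : (dimE r.ρ : ℝ) / 4 * (2 * K ^ 2) = (dimE r.ρ : ℝ) / 2 * K ^ 2 := by ring
  rw [h34] at h
  have hpow : β ^ (-(9 * θ)) ≤ β ^ (-(θ / 2)) := Real.rpow_le_rpow_of_exponent_le hβ1 (by linarith)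
  exact h.trans hpow

/-- **L1a-G at every `0 < θ ≤ 1/200`**: `GoodBoundaryCovStableG r.ρ (θ/20) θ (θ/5) (1/2)` — deep kernel covariances under crude-good data are at
least half the cold-wall one (N2-cov-G `kernelCovExpansionG_of_le`, N2-flat-G, N1 `stub_dirKernelTwoPoint`, `D ≥ 1`). [folklore] -/
theorem goodBoundaryCovStableG_explicit
    (G : Type) [Group G] [TopologicalSpace G] [IsTopologicalGroup G] [CompactSpace G] [MeasurableSpace G] [BorelSpace G]
    (hG : IsCompactSimpleLieGroup G) (r : LatticeRep G) {θ : ℝ} (hθ : 0 < θ) (hθ2 : θ ≤ 1 / 200) :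
    GoodBoundaryCovStableG r.ρ (θ / 20) θ (θ / 5) (1 / 2) := by
  haveI : SecondCountableTopology G := r.secondCountableTopology
  have hD := Summit.QuantumFields.YangMills.Cruxes.NT.LinkEquipartition.dimE_pos_of_isCompactSimpleLieGroup G r hG
  exact goodBoundaryCovStableG_at r.ρ (Nat.succ_le_of_lt hD) hθ
    (kernelCovExpansionG_of_le r.ρ r.continuous r.injective r.mem_unitary hD hθ hθ2)
    (flatCovExpansionG_explicit G hG r hθ (by linarith))
    (stub_dirKernelTwoPoint (θ / 20) θ (by positivity) (by linarith))

/-- **L1b-G at every `0 < θ ≤ 1/200`**: `GoodBoundaryMeanSmoothG r.ρ (θ/20) θ (θ/5)` (N2-mean-G `kernelMeanExpansionG_of_le` and N1′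
`dirKernelDiagFlat`). [folklore] -/
theorem goodBoundaryMeanSmoothG_explicit
    (G : Type) [Group G] [TopologicalSpace G] [IsTopologicalGroup G] [CompactSpace G] [MeasurableSpace G] [BorelSpace G]
    (hG : IsCompactSimpleLieGroup G) (r : LatticeRep G) {θ : ℝ} (hθ : 0 < θ) (hθ2 : θ ≤ 1 / 200) :
    GoodBoundaryMeanSmoothG r.ρ (θ / 20) θ (θ / 5) :=
  goodBoundaryMeanSmoothG_at r.ρ hθ (kernelMeanExpansionG_of_le G hG r hθ hθ2) dirKernelDiagFlat

/-- **L4-G at every `0 < θ ≤ 1/100`**: `BoxPolyFloorG r.ρ (θ/20) θ (2 + θ/2)` — the cold-wall covariance is eventually `≥ β^{−(2+θ/2)}`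
(BOX_G with the universal ceiling `boxTwoPointDomination_allGroups_explicit'` + the G-free FLOOR). [folklore] -/
theorem boxPolyFloorG_explicit
    (G : Type) [Group G] [TopologicalSpace G] [IsTopologicalGroup G] [CompactSpace G] [MeasurableSpace G] [BorelSpace G]
    (hG : IsCompactSimpleLieGroup G) (r : LatticeRep G) {θ : ℝ} (hθ : 0 < θ) (hθ1 : θ ≤ 1 / 100) :
    BoxPolyFloorG r.ρ (θ / 20) θ (2 + θ / 2) :=
  boxPolyFloorG_of_boxTwoPointDomination r.ρ (boxTwoPointDomination_allGroups_explicit' G hG r) hθ hθ1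

/-! ## BULK_G and the rung with explicit, `G`-uniform exponents -/

/-- **BULK_G at every `0 < θ ≤ 1/200`, every compact simple `G`, every `r`** (any Borel measurable structure on `G`): `BulkDominatesBox r.ρ (θ/20) θ`
— eventually in the torus size, the torus-state covariance of the plaquette cost and its translate by `⌈β^{θ/20}⌉` is `≥ η ×` the cold-wall box
covariance, for all large `β` (DLR assembly L3-G `stub_dlrAssemblyG` at `(A, δ, η₁, K) = (θ/20, θ/5, 1/2, 2 + θ/2)`: `K + 4δ + 2A = 2 + 1.4θ < 2 + 2θ`).
NOT the Clay mass gap. -/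
theorem bulkDominatesBox_allGroups_explicit
    (G : Type) [Group G] [TopologicalSpace G] [IsTopologicalGroup G] [CompactSpace G] [MeasurableSpace G] [BorelSpace G]
    (hG : IsCompactSimpleLieGroup G) (r : LatticeRep G) {θ : ℝ} (hθ : 0 < θ) (hθ2 : θ ≤ 1 / 200) :
    BulkDominatesBox r.ρ (θ / 20) θ :=
  stub_dlrAssemblyG G r (θ / 20) θ (θ / 5) (1 / 2) (2 + θ / 2) (by positivity) (by positivity) (by norm_num) (by linarith)
    (goodBoundaryCovStableG_explicit G hG r hθ hθ2) (goodBoundaryMeanSmoothG_explicit G hG r hθ hθ2)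
    (stub_largeFieldRarityG G r (θ / 5) (by positivity)) (boxPolyFloorG_explicit G hG r hθ (by linarith))

/-- **The rung leaf with an explicit, `G`-UNIFORM exponent: `ξ(β) ≥ β^{1/8000}` for every compact simple gauge group.**  For every compact
simple `G` (tree sense) and every faithful unitary lattice representation `r`, `MassGapPowerDecayOf 4 r.ρ (1/8000)`: for `β ≥ β₀(G, r)` every
infinite-volume torus-limit state of the 4-D Wilson theory has RP-spectral mass gap `≤ β^{−1/8000}` in lattice units.  BOX at
`(A, θ) = (1/4000, 1/200)` (`boxTwoPointDomination_allGroups_explicit`), BULK there (`bulkDominatesBox_allGroups_explicit`), FLOOR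
(`curvatureCorrPowerFloor_proof`), glue `massGapPowerDecayOf_of_box` (`ε = A/2`).  RECORD-label rung level; NOT the Clay Yang–Mills mass gap. -/
theorem massGapPowerDecay_allGroups_explicit :
    ∀ (G : Type) [Group G] [TopologicalSpace G] [IsTopologicalGroup G] [CompactSpace G],
    IsCompactSimpleLieGroup G →
    letI : MeasurableSpace G := borel G
    haveI : BorelSpace G := ⟨rfl⟩
    ∀ r : LatticeRep G, MassGapPowerDecayOf 4 r.ρ (1 / 8000) := by
  intro G _ _ _ _ hG
  letI : MeasurableSpace G := borel G
  haveI : BorelSpace G := ⟨rfl⟩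
  intro r
  have hθ : (0 : ℝ) < 1 / 200 := by norm_num
  have hA : (0 : ℝ) < 1 / 200 / 20 := by norm_num
  obtain ⟨c, hc, hB⟩ := boxTwoPointDomination_allGroups_explicit G hG r (1 / 200 / 20) (1 / 200) hA (by norm_num) (by norm_num)
  have hbulk : BulkDominatesBox r.ρ (1 / 200 / 20) (1 / 200) := bulkDominatesBox_allGroups_explicit G hG r hθ le_rfl
  have hF : ∃ κ : ℝ, 0 < κ ∧ ∃ n₀ : ℕ, ∀ n : ℕ, n₀ ≤ n → κ / (n : ℝ) ^ 4 ≤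
      |Literature.MathematicalPhysics.QuantumFieldTheory.curvaturePlaquetteCorr (d := 4) (by norm_num) (n : ℤ)| :=
    curvatureCorrPowerFloor_proof
  have key := massGapPowerDecayOf_of_box r.ρ r.continuous hA hc hB hbulk hF
  have h : (1 / 200 / 20 / 2 : ℝ) = 1 / 8000 := by norm_num
  rw [h] at key
  exact key

/-- **`XiPow` with the quantifiers swapped: ONE exponent for ALL compact simple gauge groups.**  `∃ ε > 0` (witness `1/8000`) such that for
every compact simple `G` and every faithful unitary lattice representation `r`, `MassGapPowerDecayOf 4 r.ρ ε` — the correlation length of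
every 4-D Wilson lattice gauge theory grows at least like `β^ε` with the SAME `ε`.  (Trivially implies the rung leaf `XiPow`, already proved as
`xiPow_holds`.)  RECORD-label rung level; NOT the Clay Yang–Mills mass gap; no summit statement is proved. -/
theorem xiPow_uniform :
    ∃ ε : ℝ, 0 < ε ∧ ∀ (G : Type) [Group G] [TopologicalSpace G] [IsTopologicalGroup G] [CompactSpace G],
      IsCompactSimpleLieGroup G →
      letI : MeasurableSpace G := borel G
      haveI : BorelSpace G := ⟨rfl⟩
      ∀ r : LatticeRep G, MassGapPowerDecayOf 4 r.ρ ε :=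
  ⟨1 / 8000, by norm_num, massGapPowerDecay_allGroups_explicit⟩

/-! ## Instances: `SU(N)`, `N ≥ 2`, and `SU(3)` -/

/-- **`SU(N)`, `N ≥ 2`, any faithful unitary lattice representation**: `MassGapPowerDecayOf 4 r.ρ (1/8000)`.  NOT the Clay mass gap. -/
theorem massGapPowerDecay_SU_rep_explicit {N : ℕ} (hN : 2 ≤ N) (r : LatticeRep (Matrix.specialUnitaryGroup (Fin N) ℂ)) :
    MassGapPowerDecayOf 4 r.ρ (1 / 8000) :=
  massGapPowerDecay_allGroups_explicit (Matrix.specialUnitaryGroup (Fin N) ℂ)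
    (isCompactSimpleLieGroup_specialUnitaryGroup isSimpleCompactGroup_specialUnitaryGroup_holds hN) r

/-- **`SU(N)`, `N ≥ 2`, fundamental representation**: `MassGapPowerDecayOf 4 (fundamentalRep (Fin N)) (1/8000)` — in particular for `N = 2` an
explicit exponent for the leaf `XiPowSU2`.  NOT the Clay mass gap. -/
theorem massGapPowerDecay_SU_explicit {N : ℕ} (hN : 2 ≤ N) :
    MassGapPowerDecayOf 4 (G := Matrix.specialUnitaryGroup (Fin N) ℂ) (fundamentalRep (Fin N)) (1 / 8000) :=
  massGapPowerDecay_SU_rep_explicit hN (fundamentalLatticeRep N)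

/-- **`SU(3)` (four-dimensional lattice `SU(3)` Yang–Mills theory, Wilson action, fundamental representation)**: for `β ≥ β₀` every torus-limit
state has RP-spectral mass gap `≤ β^{−1/8000}` in lattice units, i.e. `ξ(β) ≥ β^{1/8000}`.  An UPPER bound on the gap at weak coupling; NOT the
Clay mass gap. -/
theorem massGapPowerDecay_SU3_explicit :
    MassGapPowerDecayOf 4 (G := Matrix.specialUnitaryGroup (Fin 3) ℂ) (fundamentalRep (Fin 3)) (1 / 8000) :=
  massGapPowerDecay_SU_explicit (by norm_num)

end Summit.QuantumFields.YangMills.Theorems.ColdBoxAllGroups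

end
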